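import Summits.NavierStokesRegularity.NavierStokesRegularity.Theorems.ExtremiserTransienceTypeIAncientAxiallyPeriodicLiouville
import Summits.NavierStokesRegularity.NavierStokesRegularity.Theorems.ExtremiserTransienceTypeIAncientMildTimeAnalytic
import Literature.Analysis.FluidPDE.BarkerPrange2020VorticityAlignmentTypeIHolds
import HarnessLib

/-!
# Route `ExtremiserTransience`, crux `NearExtremalTransiencePerFlow` (stmt-NavierStokesRegularity-26567), LINE g9-β
# `filament_selection` §2g — RUNGS R1′ `PeriodicTypeILiouville`, P `ForwardPeriodicity`, R3 `PeriodicSliceLiouville`,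
# ALL PROVED BY NAME

Theorems file (`--supports stmt-NavierStokesRegularity-26567`).  Each theorem below is VERBATIM the corresponding Prop of the crux
workfile `Cruxes/NearExtremalTransiencePerFlow/Lines/filament_selection.lean` (ideator ns-idea-5 g9, rev 6–8) with `E3` and
`IsX3Periodic ℓ w := ∀ x, w (x + ℓ • e₃) = w x` unfolded, so that in the workfile
`theorem r1' : PeriodicTypeILiouville := …AxiallyPeriodicLiouville.periodicTypeILiouville` (etc.) close by definitional unfolding.

* R1′ `periodicTypeILiouville` — growth-free periodic Liouville: an axially `ℓ`-periodic Type-I ancient mild field is zero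
  (= `eq_zero_of_isTypeIAncientMild_of_isAxiallyPeriodic`, file `…TypeIAncientAxiallyPeriodicLiouville`).
* P `forwardPeriodicity` — a period of one slice is a period of all later slices (tree `IsTypeIAncientMild.comp_add_eq_after`,
  Barker–Prange 2020 via uniqueness of bounded Oseen-mild solutions; the workfile's own kernel-checked proof).
* R3 `periodicSliceLiouville` — ONE exactly `x₃`-periodic slice (period `ℓ > 0`, time `τ₁ < 0`) forces `W ≡ 0`: forward periodicity
  makes the real-analytic time lines `σ ↦ W σ (y + ℓe₃) − W σ y` (A, `analyticAt_time_of_isTypeIAncientMild`) vanish on `(τ₁, 0)`,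
  hence on `(−∞, 0)` (identity theorem), so `W` is periodic at all times and R1′ applies — the workfile's kernel-checked composition
  `periodicSliceLiouville_of` with its three inputs now PROVED.
* R2 `BreathingPeriodicLiouville` was landed independently by seat ns-net-p2 (`…FilamentSelection.breathingPeriodicLiouville`,
  `Theorems/ExtremiserTransienceNearExtremalTransiencePerFlowBreathingPeriodicLiouville.lean`); it also follows from R3 (any slice with
  `h τ₁ ≠ 0` has the positive period `|h τ₁|`).
HONEST FRAMING: Liouville theorems about hypothetical blow-up profiles (the `x₃`-periodic / breathing / one-periodic-slice sub-cases of
the line's heart H′ are thereby closed); H, H′, crux 26567 and Navier–Stokes regularity remain OPEN; no summit is proved by a line.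
[folklore]
-/

noncomputable section

open MeasureTheory Set Function Filter Topology Metric
open Literature.Analysis Literature.Analysis.FluidPDE

namespace Summit.NavierStokesRegularity.NavierStokesRegularity.Theorems.AxiallyPeriodicLiouville
-- the summit's namespace `Summit.NavierStokesRegularity.NavierStokesRegularity` repeats the problem name by convention (D-0017)
set_option linter.dupNamespace false

/-- **R1′ `PeriodicTypeILiouville`, EXACTLY as typed** (§2g): every axially `ℓ`-periodic (`ℓ > 0`) Type-I ancient mild field is
identically zero — the growth-free periodic Liouville theorem `eq_zero_of_isTypeIAncientMild_of_isAxiallyPeriodic`. [folklore] -/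
theorem periodicTypeILiouville :
    ∀ (K ℓ : ℝ) (W : ℝ → EuclideanSpace ℝ (Fin 3) → EuclideanSpace ℝ (Fin 3)),
      Literature.Analysis.FluidPDE.IsTypeIAncientMild K W → 0 < ℓ →
      (∀ τ : ℝ, τ < 0 → ∀ x, W τ (x + ℓ • EuclideanSpace.single (2 : Fin 3) (1 : ℝ)) = W τ x) →
      ∀ τ : ℝ, τ < 0 → ∀ x, W τ x = 0 :=
  fun _ _ _ hW hℓ hper => eq_zero_of_isTypeIAncientMild_of_isAxiallyPeriodic hW hℓ hper

/-- **P `ForwardPeriodicity`, EXACTLY as typed** (§2g): an `ℓ`-periodic slice stays `ℓ`-periodic at all later times (the tree's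
`IsTypeIAncientMild.comp_add_eq_after`: forward propagation of a spatial translation symmetry by uniqueness of bounded
Oseen-mild solutions). [folklore] -/
theorem forwardPeriodicity :
    ∀ (K ℓ : ℝ) (W : ℝ → EuclideanSpace ℝ (Fin 3) → EuclideanSpace ℝ (Fin 3)) (τ₁ : ℝ),
      Literature.Analysis.FluidPDE.IsTypeIAncientMild K W → τ₁ < 0 →
      (∀ x, W τ₁ (x + ℓ • EuclideanSpace.single (2 : Fin 3) (1 : ℝ)) = W τ₁ x) →
      ∀ τ : ℝ, τ₁ ≤ τ → τ < 0 → ∀ x, W τ (x + ℓ • EuclideanSpace.single (2 : Fin 3) (1 : ℝ)) = W τ x := by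
  intro K ℓ W τ₁ hW hτ₁ hper τ hle hτ0
  rcases eq_or_lt_of_le hle with h | h
  · subst h; exact hper
  · intro x
    exact hW.comp_add_eq_after hτ₁ hper τ h hτ0 x

/-- **R3 `PeriodicSliceLiouville`, EXACTLY as typed** (§2g): a Type-I ancient mild field with ONE exactly `x₃`-periodic slice
(period `ℓ > 0` at a time `τ₁ < 0`) is identically zero.  Forward periodicity (P) + real-analyticity of the time lines (A,
`analyticAt_time_of_isTypeIAncientMild`) + the identity theorem make `W` periodic at ALL times; then R1′. [folklore] -/
theorem periodicSliceLiouville :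
    ∀ (K ℓ : ℝ) (W : ℝ → EuclideanSpace ℝ (Fin 3) → EuclideanSpace ℝ (Fin 3)) (τ₁ : ℝ),
      Literature.Analysis.FluidPDE.IsTypeIAncientMild K W → 0 < ℓ → τ₁ < 0 →
      (∀ x, W τ₁ (x + ℓ • EuclideanSpace.single (2 : Fin 3) (1 : ℝ)) = W τ₁ x) →
      ∀ τ : ℝ, τ < 0 → ∀ x, W τ x = 0 := by
  intro K ℓ W τ₁ hW hℓ hτ₁ hper τ hτ x
  refine periodicTypeILiouville K ℓ W hW hℓ ?_ τ hτ x
  -- `ℓ`-periodicity at every time `σ < 0`, pointwise in `y`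
  intro σ hσ y
  set e3 : EuclideanSpace ℝ (Fin 3) := EuclideanSpace.single (2 : Fin 3) (1 : ℝ) with he3
  -- the pointwise difference is real-analytic on `(-∞, 0)` …
  set d : ℝ → EuclideanSpace ℝ (Fin 3) := fun σ' => W σ' (y + ℓ • e3) - W σ' y with hd
  have hdA : AnalyticOnNhd ℝ d (Set.Iio 0) := by
    intro σ' hσ'
    exact (analyticAt_time_of_isTypeIAncientMild hW (y + ℓ • e3) hσ').sub
      (analyticAt_time_of_isTypeIAncientMild hW y hσ')
  -- … and vanishes on the open interval `(τ₁, 0)` by forward periodicity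
  have hz₀ : τ₁ / 2 ∈ Set.Iio (0 : ℝ) := by
    show τ₁ / 2 < 0
    linarith
  have hev : d =ᶠ[𝓝 (τ₁ / 2)] 0 := by
    have hopen : IsOpen (Set.Ioo τ₁ 0) := isOpen_Ioo
    have hmem : τ₁ / 2 ∈ Set.Ioo τ₁ 0 := ⟨by linarith, by linarith⟩
    filter_upwards [hopen.mem_nhds hmem] with σ' hσ'
    have hp := forwardPeriodicity K ℓ W τ₁ hW hτ₁ hper σ' hσ'.1.le hσ'.2 y
    simp only [hd, Pi.zero_apply, sub_eq_zero]
    exact hp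
  have hzero := hdA.eqOn_zero_of_preconnected_of_eventuallyEq_zero isPreconnected_Iio hz₀ hev
  have hσ0 : d σ = 0 := hzero hσ
  simp only [hd, sub_eq_zero] at hσ0
  exact hσ0

end Summit.NavierStokesRegularity.NavierStokesRegularity.Theorems.AxiallyPeriodicLiouville

end
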